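import Mathlib
import HarnessLib
import Literature.AlgebraicGeometry.Ramification.InertiaNormalSylow
import Literature.AlgebraicGeometry.Resolution.ResolutionOfSingularities
import Literature.AlgebraicGeometry.Resolution.ComponentGluing
import Literature.AlgebraicGeometry.Resolution.RegularCentreBlowupSeqExtension
import Literature.AlgebraicGeometry.Resolution.MarkedIdealsEtale
import Literature.AlgebraicGeometry.Resolution.KollarBlowupSequenceFunctors
import Summits.ResolutionOfSingularities.ResolutionOfSingularities.Theorems.WildQuotientsWildQuotientResolutionTameCoreFixedLine

/-!
# Phase 0 with NON-CYCLIC tame cores: the inertia drop over `Z_M`, in every dimension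
# (crux `WildQuotients.WildQuotientResolution`, stub `stub_phaseZeroHighDim`)

Crux stmt-ResolutionOfSingularities-15640 (`WildQuotientResolution`), registered stub `stub_phaseZeroHighDim`.
The engines ✓`standardise_tameCores` (p822635) / ✓`phaseZero_of_tameCores_kernel` (p823606) blow up the inert loci
`Z_M` of normal tame cores `M` but only BOOK-KEEP cyclic overgroups `⟨g⟩ ≥ M`; for a non-cyclic core (e.g.
`V₄ ⊴ S₄`, `V₄ ⊴ A₄` in characteristic `3`, which have NO non-trivial cyclic normal subgroup of order prime to `3`)
they record nothing, although the move along `Z_{V₄}` IS what makes `S₄`/`A₄` p-closed in one step: over `Z_{V₄}`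
the new inertia group stabilises a non-trivial character of `V₄`. This file records exactly that, for any core:

* (companion ✓`…TameCoreFixedLine`: the trace lemma `mem_sq_of_mem_iSup_augIdeal_sup`, the germ lemma
  `exists_mem_stalkIdeal_le_iSup_of_subset_iUnion`, the joint kernel `exists_lineKernel`.)
* `standardise_tameCores₂` — the engine of p822635 with the SUBGROUP-LEVEL invariant `Z_M ⊆ ⋃ boundary` for every
  processed core (implies the cyclic book-keeping).
* **`phaseZero_of_tameCores_drop`** — Phase 0 (conclusion of `stub_phaseZeroHighDim`, every dimension) along a
  list of normal non-trivial tame cores `Ms` under **Condition (K⁺)**: every `H ≤ G` with a normal `U ≤ H`, `H/U`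
  abelian and `p`-torsion-free and `M ≰ U` for every `M ∈ Ms`, is p-closed. (K⁺) is implied by Condition (K) of
  p823606 (`M ≤ ⟨u⟩`, `u ∈ U` ⇒ `M ≤ U`), so this subsumes p823606 and p822635; NEW: `S₄` and `A₄` in
  characteristic `3` with `Ms = [V₄]` (every `U` as above inside `A₄` or `S₄` contains the `3`-elements, hence
  `A₄ ≥ V₄`; the other subgroups are `3`-closed) — ONE blow-up of `Z_{V₄}`, any dimension (`phaseZero_of_core_le_residual`).

[OURS · crux stmt-ResolutionOfSingularities-15640 · helper toward `stub_phaseZeroHighDim` (all-dimensional SLICE;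
NOT a proof of the stub); counted 0; AI-level work, weaker than expert review.] [folklore]
-/

-- single-problem summit: the doubled namespace component `ResolutionOfSingularities` is forced
set_option linter.dupNamespace false

noncomputable section

open CategoryTheory AlgebraicGeometry TopologicalSpace IsLocalRing
open Literature.AlgebraicGeometry.Resolution Literature.AlgebraicGeometry.Ramification
open Scheme.IdealSheafData
open Summit.ResolutionOfSingularities.ResolutionOfSingularities.Theorems.WildQuotientResolution.PointBlowupStalkData
open Summit.ResolutionOfSingularities.ResolutionOfSingularities.Theorems.WildQuotientResolution.InertLocusStalk

namespace Summit.ResolutionOfSingularities.ResolutionOfSingularities.Theorems.WildQuotientResolution.StandardForm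

/-! ## The engine with subgroup-level book-keeping -/

section Induction

variable (p : ℕ) [Fact p.Prime] (k : Type) [Field k] [CharP k p] {G : Type} [Group G] [Finite G]

/-- **p-standardisation along a list of tame cores, subgroup-level book-keeping** (as ✓`standardise_tameCores`,
recording `Z_M ⊆ ⋃ boundary` for every processed core `M`, cyclic or not). [folklore] -/
theorem standardise_tameCores₂ :
    ∀ (Ms : List (Subgroup G)), (∀ M ∈ Ms, M.Normal ∧ M ≠ ⊥ ∧ (Nat.card M).Coprime p) →
    ∀ (X : Scheme.{0}) (s : X ⟶ Spec (.of k)) [IsSeparated s] [LocallyOfFiniteType s] [IsIntegral X]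
      (ρ : G →* Aut X) (_ : Function.Injective ρ) (_ : Scheme.IsRegular X)
      (_ : ∀ g : G, (ρ g).hom ≫ s = s)
      (_ : ∀ y : X, ∃ O : X.Opens, IsAffineOpen O ∧ y ∈ O ∧ ∀ g : G, (ρ g).hom ⁻¹ᵁ O = O)
      (E : List X.IdealSheafData) (_ : HasSNC E) (_ : ∀ D ∈ E, ∀ g : G, D.comap (ρ g).hom = D)
      (done : List (Subgroup G))
      (_ : ∀ M ∈ done, {y : X | M ≤ inertiaSubgroup ρ y} ⊆ ⋃ D ∈ E, (D.support : Set X)),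
    ∃ (Xs : Scheme.{0}) (π : Xs ⟶ X) (ρs : G →* Aut Xs) (Es : List Xs.IdealSheafData),
      IsProper π ∧ IsBirational π ∧ IsIntegral Xs ∧ Scheme.IsRegular Xs ∧
      (∀ g : G, (ρs g).hom ≫ π = π ≫ (ρ g).hom) ∧
      (∀ x : Xs, ∃ U : Xs.Opens, IsAffineOpen U ∧ x ∈ U ∧ ∀ g : G, (ρs g).hom ⁻¹ᵁ U = U) ∧
      HasSNC Es ∧ (∀ D ∈ Es, ∀ g : G, D.comap (ρs g).hom = D) ∧
      (∀ M ∈ done ++ Ms, {y : Xs | M ≤ inertiaSubgroup ρs y} ⊆ ⋃ D ∈ Es, (D.support : Set Xs)) := by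
  intro Ms
  induction Ms with
  | nil =>
    intro _ X s _ _ _ ρ hfaith hreg hρ hcov E hE hEinv done hdone
    refine ⟨X, 𝟙 X, ρ, E, inferInstance, isBirational_id X, ‹_›, hreg, fun g => by simp, hcov, hE, hEinv, ?_⟩
    simpa using hdone
  | cons M Ms ih =>
    intro hMs X s _ _ _ ρ hfaith hreg hρ hcov E hE hEinv done hdone
    have hp : p.Prime := Fact.out
    obtain ⟨hMn, hMbot, hMcop⟩ := hMs M List.mem_cons_self
    haveI := hMn
    haveI : IsLocallyNoetherian X := LocallyOfFiniteType.isLocallyNoetherian s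
    have hchar : ∀ z : X, CharP (ResidueField (X.presheaf.stalk z)) p := fun z =>
      (((IsLocalRing.residue (X.presheaf.stalk z)).comp ((X.presheaf.germ ⊤ z trivial).hom.comp
        ((s.appTop).hom.comp (Scheme.ΓSpecIso (.of k)).inv.hom))).charP_iff_charP p).mp inferInstance
    -- the move along `Z_M`
    obtain ⟨X₁, π₁, ρ₁, hπ₁p, hbir₁, hX₁, hreg₁, hequiv₁, hbl₁, hle₁, hcov₁, hfaith₁, hρ₁⟩ :=
      tameMove' p hp k X s G ρ hfaith hreg hρ hcov M hMbot hMcop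
    haveI := hπ₁p; haveI := hX₁
    haveI : IsLocallyNoetherian X₁ := LocallyOfFiniteType.isLocallyNoetherian (π₁ ≫ s)
    have hZ : IsClosed {y : X | M ≤ inertiaSubgroup ρ y} :=
      PointMoveNoNpcCurves.isClosed_setOf_le_inertia s ρ hρ M
    set Z : Closeds X := ⟨{y : X | M ≤ inertiaSubgroup ρ y}, hZ⟩ with hZdef
    set 𝒥 : X.IdealSheafData := vanishingIdeal Z with h𝒥def
    have h𝒥inv : ∀ g : G, 𝒥.comap (ρ g).hom = 𝒥 := comap_vanishingIdeal_inertLocus ρ M hZ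
    -- the new boundary
    set E₁ : List X₁.IdealSheafData := E.map (strictTransformIdeal π₁ 𝒥) ++ [𝒥.comap π₁] with hE₁def
    have hEstab : ∀ D ∈ E, ∀ g : G, (ρ g).hom.base ⁻¹' (D.support : Set X) = D.support :=
      fun D hD g => preimage_support_of_comap_eq ρ g (hEinv D hD g)
    have hsncW : HasSNCWith E 𝒥 := hasSNCWith_inertLocus_of_hasSNC ρ p M hchar hMcop hZ E hE hEstab
    have hE₁ : HasSNC E₁ := hsncW.hasSNC_transform hbl₁
    have hE₁inv : ∀ D ∈ E₁, ∀ g : G, D.comap (ρ₁ g).hom = D := by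
      intro D hD g
      rw [hE₁def, List.mem_append, List.mem_map, List.mem_singleton] at hD
      rcases hD with ⟨D₀, hD₀, rfl⟩ | rfl
      · exact strictTransformIdeal_comap_of_invariant ρ₁ ρ π₁ hequiv₁ h𝒥inv (hEinv D₀ hD₀) g
      · exact comap_comap_of_invariant ρ₁ ρ π₁ hequiv₁ h𝒥inv g
    -- supports upstairs
    have hexc : ((𝒥.comap π₁).support : Set X₁) = π₁.base ⁻¹' {y : X | M ≤ inertiaSubgroup ρ y} := by
      rw [support_comap]
      change π₁.base ⁻¹' ((𝒥.support : Closeds X) : Set X) = _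
      rw [h𝒥def, Scheme.IdealSheafData.coe_support_vanishingIdeal]
      rfl
    have hunion₁ : ∀ D ∈ E, π₁.base ⁻¹' (D.support : Set X) ⊆ ⋃ D' ∈ E₁, (D'.support : Set X₁) := by
      intro D hD y hy
      rcases preimage_support_subset_strict_union_exceptional π₁ 𝒥 D hy with h | h
      · exact Set.mem_biUnion (show strictTransformIdeal π₁ 𝒥 D ∈ E₁ by
          rw [hE₁def]; exact List.mem_append_left _ (List.mem_map.mpr ⟨D, hD, rfl⟩)) h
      · exact Set.mem_biUnion (show 𝒥.comap π₁ ∈ E₁ by rw [hE₁def]; simp) h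
    -- persistence for `done`, establishment for `M`
    have hdone₁ : ∀ M' ∈ done ++ [M],
        {y : X₁ | M' ≤ inertiaSubgroup ρ₁ y} ⊆ ⋃ D ∈ E₁, (D.support : Set X₁) := by
      intro M' hM' y hy
      have hy' : π₁.base y ∈ {y : X | M' ≤ inertiaSubgroup ρ y} := le_trans hy (hle₁ y)
      rw [List.mem_append, List.mem_singleton] at hM'
      rcases hM' with hM' | rfl
      · obtain ⟨D, hD, hyD⟩ := Set.mem_iUnion₂.mp (hdone M' hM' hy')
        exact hunion₁ D hD (show y ∈ π₁.base ⁻¹' (D.support : Set X) from hyD)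
      · refine Set.mem_biUnion (show 𝒥.comap π₁ ∈ E₁ by rw [hE₁def]; simp) ?_
        rw [SetLike.mem_coe, ← SetLike.mem_coe, hexc]
        exact hy'
    -- recurse
    obtain ⟨X₂, π₂, ρ₂, E₂, hπ₂p, hbir₂, hX₂, hreg₂, hequiv₂, hcov₂, hE₂, hE₂inv, hdone₂⟩ :=
      ih (fun M' hM' => hMs M' (List.mem_cons_of_mem M hM')) X₁ (π₁ ≫ s) ρ₁ hfaith₁ hreg₁ hρ₁ hcov₁
        E₁ hE₁ hE₁inv (done ++ [M]) hdone₁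
    haveI := hπ₂p
    refine ⟨X₂, π₂ ≫ π₁, ρ₂, E₂, inferInstance, ComponentGluing.IsBirational.comp hbir₂ hbir₁, hX₂, hreg₂,
      fun g => ?_, hcov₂, hE₂, hE₂inv, ?_⟩
    · rw [← Category.assoc, hequiv₂ g, Category.assoc, hequiv₁ g, Category.assoc]
    · intro M' hM'
      refine hdone₂ M' ?_
      simpa [List.append_assoc] using hM'

end Induction

/-! ## The theorem -/

/-- **Phase 0 in every dimension along a list of tame cores, under Condition (K⁺)** (crux
stmt-ResolutionOfSingularities-15640, an all-dimensional SLICE of `stub_phaseZeroHighDim` containing p823606 and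
p822635). Let `Ms` be a list of non-trivial normal subgroups of `G` of order prime to `p` (cyclic or not) such that
every `H ≤ G` with a normal `U ≤ H`, `H/U` abelian and `p`-torsion-free and `M ≰ U` for all `M ∈ Ms`, is p-closed.
Then the conclusion of `stub_phaseZeroHighDim` holds for every crux datum: blow up the `Z_M` in turn; at a point `x`
of the final model with `M ≤ U ≤ I_x`, the germ of `Z_M` lies in a boundary divisor `D ∋ x`, so its equation `z_D`
lies in `𝔞_{M,x}`, while `M ≤ U` fixes the line of `z_D` — contradiction (`mem_sq_of_mem_iSup_augIdeal_sup`).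
[folklore] -/
theorem phaseZero_of_tameCores_drop (p : ℕ) (hp : p.Prime) (k : Type) [Field k] [CharP k p]
    (X' X₁ : Scheme.{0}) (f : X₁ ⟶ Spec (.of k)) (q : X' ⟶ X₁) (G : Type) [Group G] [Finite G]
    (ρ : G →* Aut X') (hfaith : Function.Injective ρ)
    [IsSeparated f] [LocallyOfFiniteType f] [QuasiCompact f] [IsIntegral X']
    (hreg : Scheme.IsRegular X') [IsFinite q] (hρ : ∀ g : G, (ρ g).hom ≫ q = q)
    (Ms : List (Subgroup G)) (hMs : ∀ M ∈ Ms, M.Normal ∧ M ≠ ⊥ ∧ (Nat.card M).Coprime p)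
    (hcore : ∀ H U : Subgroup G, U ≤ H → (∀ h ∈ H, ∀ u ∈ U, h * u * h⁻¹ ∈ U) →
      (∀ a ∈ H, ∀ b ∈ H, a * b * a⁻¹ * b⁻¹ ∈ U) → (∀ g ∈ H, g ^ p ∈ U → g ∈ U) →
      (∀ M ∈ Ms, ¬ M ≤ U) → HasNormalSylow p H) :
    ∃ (Xs : Scheme.{0}) (π : Xs ⟶ X') (ρs : G →* Aut Xs), IsProper π ∧ IsBirational π ∧
      IsIntegral Xs ∧ Scheme.IsRegular Xs ∧ (∀ g : G, (ρs g).hom ≫ π = π ≫ (ρ g).hom) ∧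
      (∀ x : Xs, HasNormalSylow p (inertiaSubgroup ρs x)) ∧
      ∀ x : Xs, ∃ U : Xs.Opens, IsAffineOpen U ∧ x ∈ U ∧ ∀ g : G, (ρs g).hom ⁻¹ᵁ U = U := by
  classical
  haveI : Fact p.Prime := ⟨hp⟩
  set s₀ : X' ⟶ Spec (.of k) := q ≫ f with hs₀
  obtain ⟨hρ₀, hcov₀⟩ := iterHypotheses_of_cruxData X' X₁ f q ρ hρ
  haveI : IsLocallyNoetherian X' := LocallyOfFiniteType.isLocallyNoetherian s₀
  obtain ⟨Xs, π, ρs, Es, hπp, hbir, hXs, hXsreg, hequiv, hcov, hEs, hEsinv, hest⟩ :=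
    standardise_tameCores₂ p k Ms hMs X' s₀ ρ hfaith hreg hρ₀ hcov₀ [] (hasSNC_nil_of_isRegular hreg)
      (fun D hD => absurd hD (by simp)) [] (fun M hM => absurd hM (by simp))
  haveI := hπp; haveI := hXs
  have hρs : ∀ g : G, (ρs g).hom ≫ (π ≫ s₀) = π ≫ s₀ := fun g => by
    rw [← Category.assoc, hequiv g, Category.assoc, hρ₀ g]
  have hcharS : ∀ x : Xs, CharP (ResidueField (Xs.presheaf.stalk x)) p := fun x =>
    (((IsLocalRing.residue (Xs.presheaf.stalk x)).comp ((Xs.presheaf.germ ⊤ x trivial).hom.comp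
      (((π ≫ s₀).appTop).hom.comp (Scheme.ΓSpecIso (.of k)).inv.hom))).charP_iff_charP p).mp inferInstance
  have hZ' : ∀ K : Subgroup G, IsClosed {x : Xs | K ≤ inertiaSubgroup ρs x} := fun K =>
    PointMoveNoNpcCurves.isClosed_setOf_le_inertia (π ≫ s₀) ρs hρs K
  have hEstab : ∀ D ∈ Es, ∀ g : G, (ρs g).hom.base ⁻¹' (D.support : Set Xs) = D.support :=
    fun D hD g => preimage_support_of_comap_eq ρs g (hEsinv D hD g)
  refine ⟨Xs, π, ρs, hπp, hbir, hXs, hXsreg, hequiv, fun x => ?_, hcov⟩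
  haveI := hcharS x
  haveI := hXsreg x
  -- boundary members through `x`
  let T := {D' : Xs.IdealSheafData // D' ∈ Es ∧ x ∈ D'.support}
  haveI hTfin : Finite T :=
    (((List.finite_toSet Es).subset (fun D' (h : D' ∈ Es ∧ x ∈ D'.support) => h.1)).to_subtype :
      Finite {D' : Xs.IdealSheafData | D' ∈ Es ∧ x ∈ D'.support})
  haveI : Fintype T := Fintype.ofFinite T
  let n := Fintype.card T
  let e : T ≃ Fin n := Fintype.equivFin T
  obtain ⟨hregx, u, hu, ⟨ι, hιinj, hι⟩, -⟩ := hEs x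
  have hrsop : IsRsopPart (u ∘ id) := isRsopPart_comp_of_rsop rfl u hu id Function.injective_id
  let z : Fin n → Xs.presheaf.stalk x := fun i => u (ι (e.symm i))
  have hzT : ∀ D' : T, z (e D') = u (ι D') := fun D' => by simp only [z, Equiv.symm_apply_apply]
  have hvs : ∀ D' : T, stalkIdeal (vanishingIdeal D'.1.support) x = Ideal.span {u (ι D')} := fun D' => by
    rw [hEs.vanishingIdeal_support D'.2.1, hι D']
  -- the stalk action of `I_x` and the stable lines
  obtain ⟨a, τ, hkey, hτ⟩ := exists_stalkAction ρs x (inertiaSubgroup ρs x)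
    (fun g hg => apply_eq_of_mem_inertiaSubgroup ρs hg)
  have hres : ∀ (g : inertiaSubgroup ρs x) (s : Xs.presheaf.stalk x),
      τ g s - s ∈ maximalIdeal (Xs.presheaf.stalk x) :=
    stalkAction_residueTrivial ρs x a τ hkey hτ le_rfl
  have hz : ∀ i, z i ∈ maximalIdeal (Xs.presheaf.stalk x) := fun i => hu ▸ Ideal.subset_span ⟨_, rfl⟩
  have hz2 : ∀ i, z i ∉ maximalIdeal (Xs.presheaf.stalk x) ^ 2 := fun i => hrsop.not_mem_sq _
  have hstab : ∀ (g : inertiaSubgroup ρs x) (i : Fin n),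
      τ g (z i) ∈ Ideal.span {z i} ⊔ maximalIdeal (Xs.presheaf.stalk x) ^ 2 := fun g i =>
    apply_mem_span_of_stalkIdeal_eq_span ρs x a τ hkey hτ (e.symm i).1.support
      (fun g => hEstab _ (e.symm i).2.1 (g : G)) (hvs (e.symm i)) g
  -- the joint kernel, and Condition (K⁺)
  obtain ⟨U, hUle, hUn, hcomm, hroot, hU⟩ := exists_lineKernel ρs p x a τ hkey hτ le_rfl z hz hstab
  refine hcore _ U hUle hUn hcomm hroot fun M hM hMU => ?_
  -- `M ≤ U ≤ I_x`: the germ of `Z_M` lies in a boundary divisor `D ∋ x`, whose equation is in `𝔞_{M,x}` …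
  obtain ⟨-, -, hMcop⟩ := hMs M hM
  have hMx : M ≤ inertiaSubgroup ρs x := hMU.trans hUle
  have hsub : {y : Xs | M ≤ inertiaSubgroup ρs y} ⊆ ⋃ D ∈ Es, (D.support : Set Xs) := hest M (by simpa using hM)
  obtain ⟨D, hD, hxD, hle⟩ :=
    exists_mem_stalkIdeal_le_iSup_of_subset_iUnion ρs p x a τ hkey hτ hMx hMcop hMx (hZ' M) Es hsub
  have hzD : z (e ⟨D, hD, hxD⟩) ∈ (⨆ m : M, augIdeal ((τ.comp (Subgroup.inclusion hMx)) m)) ⊔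
      maximalIdeal (Xs.presheaf.stalk x) ^ 2 := by
    rw [hzT]
    exact Ideal.mem_sup_left (hle ((hvs ⟨D, hD, hxD⟩) ▸ Ideal.mem_span_singleton_self _))
  -- … while `M ≤ U` fixes its line: contradiction
  haveI : Fintype M := Fintype.ofFinite M
  have hMu : IsUnit ((Fintype.card M : ℕ) : Xs.presheaf.stalk x) := by
    rw [← Nat.card_eq_fintype_card]
    exact TameFixedLocus.isUnit_natCast_of_not_dvd p
      ((Nat.Prime.coprime_iff_not_dvd (Fact.out : p.Prime)).mp hMcop.symm)
  refine hz2 (e ⟨D, hD, hxD⟩) (mem_sq_of_mem_iSup_augIdeal_sup (τ.comp (Subgroup.inclusion hMx))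
    (fun m r => hres _ r) hMu hzD fun m => ?_)
  exact hU (Subgroup.inclusion hMx m) (hMU m.2) _

/-- **Condition (K) implies Condition (K⁺)** (`M ≤ ⟨u⟩` with `u ∈ U` gives `M ≤ U`): so `phaseZero_of_tameCores_drop`
contains ✓`phaseZero_of_tameCores_kernel` (p823606), hence ✓`phaseZero_of_tameCores` (p822635). [folklore] -/
theorem hcoreDrop_of_hcoreK {G : Type} [Group G] (p : ℕ) (Ms : List (Subgroup G))
    (hcore : ∀ H U : Subgroup G, U ≤ H → (∀ h ∈ H, ∀ u ∈ U, h * u * h⁻¹ ∈ U) →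
      (∀ a ∈ H, ∀ b ∈ H, a * b * a⁻¹ * b⁻¹ ∈ U) → (∀ g ∈ H, g ^ p ∈ U → g ∈ U) →
      (∀ u ∈ U, (orderOf u).Coprime p → ∀ M ∈ Ms, ¬ M ≤ Subgroup.zpowers u) → HasNormalSylow p H) :
    ∀ H U : Subgroup G, U ≤ H → (∀ h ∈ H, ∀ u ∈ U, h * u * h⁻¹ ∈ U) →
      (∀ a ∈ H, ∀ b ∈ H, a * b * a⁻¹ * b⁻¹ ∈ U) → (∀ g ∈ H, g ^ p ∈ U → g ∈ U) →
      (∀ M ∈ Ms, ¬ M ≤ U) → HasNormalSylow p H :=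
  fun H U hUH hUn hcomm hroot hU => hcore H U hUH hUn hcomm hroot fun _ hu _ M hM hMu =>
    hU M hM (hMu.trans ((Subgroup.zpowers_le).mpr hu))

/-- **One core inside the `p′`-abelian residual of every non-p-closed subgroup** (crux
stmt-ResolutionOfSingularities-15640): if `N ⊴ G` is non-trivial of order prime to `p` and every non-p-closed
`H ≤ G` has `N ≤ [H, H] ⊔ ⟨p-elements of H⟩` — more generally `N ≤ U` for every normal `U ≤ H` with `H/U` abelian
`p`-torsion-free — then ONE tame move along `Z_N` gives Phase 0 for every crux datum, in every dimension. Examples: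
`S₄`, `A₄` in characteristic `3` with `N = V₄`; `C_ℓ ≀ C_2` in characteristic `2` with `N` the anti-diagonal;
`SL₂(𝔽₃)` in characteristic `3` with `N = {±1}`… [folklore] -/
theorem phaseZero_of_core_le_residual (p : ℕ) (hp : p.Prime) (k : Type) [Field k] [CharP k p]
    (X' X₁ : Scheme.{0}) (f : X₁ ⟶ Spec (.of k)) (q : X' ⟶ X₁) (G : Type) [Group G] [Finite G]
    (ρ : G →* Aut X') (hfaith : Function.Injective ρ)
    [IsSeparated f] [LocallyOfFiniteType f] [QuasiCompact f] [IsIntegral X']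
    (hreg : Scheme.IsRegular X') [IsFinite q] (hρ : ∀ g : G, (ρ g).hom ≫ q = q)
    (N : Subgroup G) [N.Normal] (hN : N ≠ ⊥) (hNcop : (Nat.card N).Coprime p)
    (hres : ∀ H U : Subgroup G, ¬ HasNormalSylow p H → U ≤ H → (∀ h ∈ H, ∀ u ∈ U, h * u * h⁻¹ ∈ U) →
      (∀ a ∈ H, ∀ b ∈ H, a * b * a⁻¹ * b⁻¹ ∈ U) → (∀ g ∈ H, g ^ p ∈ U → g ∈ U) → N ≤ U) :
    ∃ (Xs : Scheme.{0}) (π : Xs ⟶ X') (ρs : G →* Aut Xs), IsProper π ∧ IsBirational π ∧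
      IsIntegral Xs ∧ Scheme.IsRegular Xs ∧ (∀ g : G, (ρs g).hom ≫ π = π ≫ (ρ g).hom) ∧
      (∀ x : Xs, HasNormalSylow p (inertiaSubgroup ρs x)) ∧
      ∀ x : Xs, ∃ U : Xs.Opens, IsAffineOpen U ∧ x ∈ U ∧ ∀ g : G, (ρs g).hom ⁻¹ᵁ U = U := by
  refine phaseZero_of_tameCores_drop p hp k X' X₁ f q G ρ hfaith hreg hρ [N] (fun M hM => ?_)
    fun H U hUH hUn hcomm hroot hU => ?_
  · rw [List.mem_singleton] at hM
    subst hM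
    exact ⟨‹_›, hN, hNcop⟩
  · by_contra hH
    exact hU N (by simp) (hres H U hH hUH hUn hcomm hroot)

/-! ## The residual form of Condition (K⁺) -/

/-- The subgroup generated by the commutators and the `p`-elements of `H` lies in every «admissible» `U ≤ H`
(`U` normal in `H` with `H/U` abelian and `p`-torsion-free): it is the LEAST admissible subgroup, the
`p′`-abelian residual of `H`. [folklore] -/
theorem commutator_sup_closure_le_of_admissible {G : Type} [Group G] (p : ℕ) (H U : Subgroup G)
    (hcomm : ∀ a ∈ H, ∀ b ∈ H, a * b * a⁻¹ * b⁻¹ ∈ U) (hroot : ∀ g ∈ H, g ^ p ∈ U → g ∈ U) :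
    ⁅H, H⁆ ⊔ Subgroup.closure {g : G | g ∈ H ∧ ∃ n : ℕ, g ^ p ^ n = 1} ≤ U := by
  refine sup_le (Subgroup.commutator_le.mpr fun a ha b hb => by
    rw [commutatorElement_def]; exact hcomm a ha b hb) ((Subgroup.closure_le _).mpr ?_)
  rintro g ⟨hg, n, hn⟩
  induction n generalizing g with
  | zero =>
    rw [pow_zero, pow_one] at hn
    rw [hn]
    exact one_mem _
  | succ n ih =>
    refine hroot g hg (ih (H.pow_mem hg p) ?_)
    rw [← pow_mul, ← pow_succ', hn]

/-- **Residual form of `phaseZero_of_tameCores_drop`** (crux stmt-ResolutionOfSingularities-15640): if every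
non-p-closed `H ≤ G` contains a core `M ∈ Ms` inside its `p′`-abelian residual `[H, H]·⟨p-elements of H⟩`, then the
conclusion of `stub_phaseZeroHighDim` holds for every crux datum, in every dimension. This is Condition (K⁺) made
checkable: `S₄`, `A₄` in characteristic `3` (`M = V₄ = [A₄, A₄] ≤ [S₄, S₄]`), `C_ℓ ≀ C_2` in characteristic `2`
(`M` = anti-diagonal `= [H, H]` for both non-2-closed `H`), `SL₂(𝔽₃)` in characteristic `3` (`M = {±1}`), every
`G` with a non-trivial normal tame subgroup contained in the residual of every non-p-closed subgroup. [folklore] -/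
theorem phaseZero_of_tameCores_residual (p : ℕ) (hp : p.Prime) (k : Type) [Field k] [CharP k p]
    (X' X₁ : Scheme.{0}) (f : X₁ ⟶ Spec (.of k)) (q : X' ⟶ X₁) (G : Type) [Group G] [Finite G]
    (ρ : G →* Aut X') (hfaith : Function.Injective ρ)
    [IsSeparated f] [LocallyOfFiniteType f] [QuasiCompact f] [IsIntegral X']
    (hreg : Scheme.IsRegular X') [IsFinite q] (hρ : ∀ g : G, (ρ g).hom ≫ q = q)
    (Ms : List (Subgroup G)) (hMs : ∀ M ∈ Ms, M.Normal ∧ M ≠ ⊥ ∧ (Nat.card M).Coprime p)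
    (hres : ∀ H : Subgroup G, ¬ HasNormalSylow p H →
      ∃ M ∈ Ms, M ≤ ⁅H, H⁆ ⊔ Subgroup.closure {g : G | g ∈ H ∧ ∃ n : ℕ, g ^ p ^ n = 1}) :
    ∃ (Xs : Scheme.{0}) (π : Xs ⟶ X') (ρs : G →* Aut Xs), IsProper π ∧ IsBirational π ∧
      IsIntegral Xs ∧ Scheme.IsRegular Xs ∧ (∀ g : G, (ρs g).hom ≫ π = π ≫ (ρ g).hom) ∧
      (∀ x : Xs, HasNormalSylow p (inertiaSubgroup ρs x)) ∧
      ∀ x : Xs, ∃ U : Xs.Opens, IsAffineOpen U ∧ x ∈ U ∧ ∀ g : G, (ρs g).hom ⁻¹ᵁ U = U := by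
  refine phaseZero_of_tameCores_drop p hp k X' X₁ f q G ρ hfaith hreg hρ Ms hMs
    fun H U _ _ hcomm hroot hU => ?_
  by_contra hH
  obtain ⟨M, hM, hMle⟩ := hres H hH
  exact hU M hM (hMle.trans (commutator_sup_closure_le_of_admissible p H U hcomm hroot))

end Summit.ResolutionOfSingularities.ResolutionOfSingularities.Theorems.WildQuotientResolution.StandardForm

end
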